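import Summits.QuantumFields.YangMills.Theorems.BalabanUVNodesN07NormalisationDbarFrames
import HarnessLib

/-!
# N07 [B11] (= [15] = [Balaban1985Variational]) Sect. F — **THE NORMALISATION OF RECORD IN DOUBLE-BAR CURRENCY, ON THE WINDOW FAMILY** `NrmDbarWideOfRecord`: MODULE 91's
# `NrmDbarOfRecord` with ONE geometric token changed — the per-cell-site equation is imposed on the cells of `D̃ := (□̃-tower) ⊓ Ω(s)` (`□̃ = box ± 2ρ`: corner `cornerP − ρ`,
# side `sideP + 2ρ`) instead of `D″ := (□-tower) ⊓ Ω(s)` (`□ = box ± ρ`) — cure (α⁗-W) of ⚑ LOCATED-OUT-END-FRAME (cell bus, this seat, 2026-08-29)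

Cell `pub-ymgap`, seat `pub-ymgap-dag-n07-e` g27 (FAN-OUT §N07 row s3; LANE OWNER of the K0 road), MODULE 91″ (INTENT-91″, cell bus).  `--kind definition --supports stmt-QuantumFields-20541
--as helper` (K0⁷); count-neutral.  ONE `def` (a displayed predicate, NEVER asserted) + two readers; nothing landed is edited: 91 `NrmDbarOfRecord` stays (a resting text, its §1
bookkeeping `toUT` ∕ `unitsField_toUField_gaugeAct` ∕ `toUT_toMS_succ` REUSED here by import), as do 60′ and 87.
[15] = [Balaban1985Variational]; [3] = [Balaban1985Averaging]; [6] = [Balaban1985RegularSpaces]; [4] = [Balaban1984PropagatorsII].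

WHY (⚑ LOCATED-OUT-END-FRAME).  The chart's near class (MODULE 77b) at the top level is «every `c : BondIdx D″` of level `j`» — including the bonds `(y, y′)` from a top cell `y ∈ □_j ∩ Ω_j`
to `y′ ∉ D″.Om j`.  MODULE 91's reader needs the per-site equation at BOTH ends; at an end that is not a cell of the normalisation family the double-bar currency carries the FRAME FACTOR
`vframeU (U̿^{(j−1)}(U^u)♮) y′` (UST (92)'s effective gauge one level down), which is δ-type when `y′ ∉ Ω_j` (the block `B(y′)` lies over the data `W_{j−1}`; print's (160), second case)
but only ε-type when `y′ ∈ Ω_j ∖ □_j` (plaquettes of `M^{j−1}U` inside an `Ω_j`-block) — not budgetable.  Imposing the equation on the cells of the WINDOW family instead makes every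
such `y′ ∈ □_j + 1 ⊆ □̃` a cell (frame factor `1`), leaves only out-ends over data, and keeps the `L·M_h`-grid alignment of the cube (the widening is by `ρ`, a multiple of `L·M_h`), so
the (2.2)-admissibility of `D̃` is the landed `adm22_meetCube_trunc_seqOfRecord` verbatim.  The certificate MODULES 92a∕92b are generic in the family and transfer by a corollary (92c).

WHAT THIS FILE DECLARES ∕ PROVES (sorry-free; axioms standard; NOTHING of [15]∕[3]∕[6]∕[4] analysis).
* §1 `NrmDbarWideOfRecord F N Mc ρ : <MODULE 59's `Nrm` type>` — 91's clauses VERBATIM with `cornerP ↦ cornerP − ρ`, `sideP ↦ sideP + 2ρ` inside the clause's `domainsMeet` ONLY (the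
  rooted top gauge `h` keeps its window `[tLo, tHi]` and root `ctr` of the print box).  NEVER asserted.
* §2 ★★★ `NrmDbarWideOfRecord.dbar_eq_iter_rep` — for the witness `w` and every bond `c` of level `j′ ≤ j` with both ends cells of `D̃`:
  `dbarIterU j′ ((U^u)♮) c = emlIterU j′ (((U^{h̄·w}))♮) c` (UST `dbarIterU_gaugeActT_eq` + `emlIterU_gaugeActT` + the per-site equation at both ends; 91's proof byte for byte);
  ★★ `NrmDbarWideOfRecord.dbar_eq_top_dataAxial` — the top level, with `M^j(U^w) = M^jU` recorded (`w` residual).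
HONEST SCOPE.  One displayed predicate (it DISCHARGES NOTHING) + kernel algebra over LANDED theorems; the door for this predicate is the CONDITIONAL premise `HThm4Rec` re-texted at it
(MODULE 88″); HS3NORM ∕ HCHART ∕ HBUDGET stay displayed; (c′) is OWED (MODULES 93–96 of the bus plan); K0⁷ ∕ K1⁹ NOT closed; N07 ∕ N05 NOT discharged; counts unmoved (typed 28∕28 ·
discharged 8∕27 per the chair); one finite 𝕋⁴ programme at fixed ε — the route closes the conditional finite-𝕋⁴ rung `BalabanLadder.UV` ONLY; the YM mass gap (Clay) is NOT proved by any
of this; nothing continuum ∕ ℝ⁴ ∕ OS.  ONE `def`, no `instance`, no `notation`, no `sorry`.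

References: [3] (11) p. 19, (78)–(82) p. 30, (85)–(92) p. 31, (97)–(100) p. 32; [15] (144) p. 300, (147) p. 301, (150)–(156) pp. 301–302, (160) p. 303; [6] p. 98, (1.15) p. 78, (1.29) p. 81,
(1.131) p. 99; [4] (2.1)–(2.4) p. 224.
-/

set_option autoImplicit false

noncomputable section

open scoped Matrix.Norms.L2Operator

namespace Summit.QuantumFields.YangMills.BalabanUVNodes.N07NormalisationDbarFramesWide

open Literature.MathematicalPhysics.QuantumFieldTheory.Balaban1983to89
open Literature.MathematicalPhysics.QuantumFieldTheory.Balaban1983to89.Node00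
open T4Continuum (T4Family)
open T4AxialGaugeRooted (axialGaugeAt)
open B12GaugeOrbits021 (IsResidual)
open B15Eq177GaugeInvariance (blockLift)
open B16Sect1Backgrounds (toMS)
open B14DomainGeom (Pt)
open B8Eq131Cubes (tLo tHi ctr)
open GaugeField (gaugeAct)
open B10Eq27TorusAxialLog (unitsField toUField suIncl gaugeActT gaugeActT_apply val_unitsField)
open Summit.QuantumFields.Balaban3D.Carriers (radialContourData)
open Summit.QuantumFields.YangMills.Theorems.Prop8Chart (emlIterU emlIterU_gaugeActT)
open Summit.QuantumFields.YangMills.Theorems.Prop8ChartDoubleBar (vframeU dbarIterU dbarIterU_gaugeActT_eq)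
open Summit.QuantumFields.YangMills.BalabanUVNodes.N07NormalisationDbarFrames (toUT unitsField_toUField_gaugeAct toUT_toMS_succ)

/-! ## §1  The definition (91's text on the WINDOW family) -/

/-- **THE NORMALISATION OF RECORD IN DOUBLE-BAR CURRENCY ON THE WINDOW FAMILY** — MODULE 91's `NrmDbarOfRecord` VERBATIM except that the per-cell-site equation
`V_{j′}(y)⁻¹ · u(y) = (h̄·w)(y)` is imposed at the cell sites of the WINDOW family `D̃ := (□̃-tower) ⊓ Ω(s)`, `□̃ = box ± 2ρ` (corner `cornerP − ρ`, side `sideP + 2ρ`), instead of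
`D″ = (□-tower) ⊓ Ω(s)`: so that the top bonds of `D″` leaving `□_j` inside `Ω_j` have BOTH ends normalised (cure (α⁗-W) of ⚑ LOCATED-OUT-END-FRAME).  For the datum `(j, idx)`, the
minimiser `U` and S3's gauge `u`: a residual `w` of level `j` with `U^{w}` radial-axial below `j` and, for every accumulated-frame family `V` of `(U^u)♮`, the equation at every
`y ∈ Λ̃_{j′}(D̃)`, `j′ ≤ j`; `h` the top axial gauge of `M^j(U^w)` on `□̃` rooted at its centre.  A displayed predicate, NEVER asserted.
[cite: Balaban1985Averaging, (87) p.31, (92) p.31, (97) p.32; Balaban1985Variational, (144) p.300, (147) p.301, (150)–(154) pp.301–302; Balaban1985RegularSpaces, p.98, (1.29) p.81; Balaban1987RG1, (0.11) p.253] -/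
def NrmDbarWideOfRecord (F : T4Family) (N : ℕ) [NeZero N] (Mc ρ : ℕ) :
    ∀ (ν : Stage7Numerics) (M : ℕ) (g : ℕ → ℝ) (K k : ℕ), SeqOfRecord F ν M g K k → GaugeField (F.P K) 0 (SU N) → ℕ → Pt (F.P K).d →
      GaugeTransf (F.P K) 0 (SU N) → (PBond (F.P K) 0 → MatA N) → Prop :=
  fun _ν _M _g K _k s U j idx u _A =>
    ∃ w : GaugeTransf (F.P K) 0 (SU N), IsResidual j w ∧
      (∀ i < j, AxialGauge (radialContourData (F.P K) i (SU N)) (Averaging.iter (avOfRecord F N K) i (gaugeAct w U))) ∧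
      ∀ (hk : j ≤ (F.P K).m + (F.P K).K) (V : (i : ℕ) → Site (F.P K) i → (Matrix (Fin N) (Fin N) ℂ)ˣ),
        (∀ x, V 0 x = 1) →
        (∀ (i : ℕ) (y : Site (F.P K) (i + 1)), V (i + 1) y = V i (emb y) * vframeU (dbarIterU i (unitsField (toUField (gaugeAct u U)))) y) →
        ∀ (j' : ℕ), j' ≤ j → ∀ y : Site (F.P K) j',
          (domainsMeet (cubeDomains (F.P K) (cornerP (F.P K) Mc ρ idx - ((ρ : ℕ) : Pt (F.P K).d)) (sideP (F.P K) Mc ρ + 2 * ρ) ρ j hk) (domainsOfSeq s.Ω j hk)).LamSite j' y →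
            (V j' y)⁻¹ * toUT (toMS u j') y =
              toUT (toMS (fun x => blockLift j (axialGaugeAt (Averaging.iter (avOfRecord F N K) j (gaugeAct w U))
                  (tLo (cornerP (F.P K) Mc ρ idx) ρ) (tHi (cornerP (F.P K) Mc ρ idx) (sideP (F.P K) Mc ρ) ρ) (ctr (cornerP (F.P K) Mc ρ idx) (sideP (F.P K) Mc ρ))) x * w x) j') y

/-! ## §2  The double-bar averages of the Landau copy ARE the plain averages of the representative on the window family's cell bonds -/

section Derived

variable {F : T4Family} {N : ℕ} [NeZero N]

/-- ★★★ **UNDER `NrmDbarWideOfRecord`, `U̿^{(j′)}(U^u)(c) = Ū^{(j′)}((U^w)^{h̄})(c)` AT EVERY BOND WITH BOTH ENDS CELL SITES OF `D̃`** (`j′ ≤ j`): UST's fundamental equality (92)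
`dbarIterU_gaugeActT_eq` for the reading `toUT ∘ toMS u`, then the per-site equation at both ends, then the covariance `emlIterU_gaugeActT` for `toUT ∘ toMS (h̄·w)` backwards.
Pure algebra; no smallness. [cite: Balaban1985Averaging, (11) p.19, (87)–(88) p.31, (92) p.31, (97)–(99) p.32; Balaban1985Variational, (154) p.302] -/
theorem NrmDbarWideOfRecord.dbar_eq_iter_rep {Mc ρ : ℕ} {ν : Stage7Numerics} {M : ℕ} {g : ℕ → ℝ} {K k : ℕ}
    {s : SeqOfRecord F ν M g K k} {U : GaugeField (F.P K) 0 (SU N)} {j : ℕ} {idx : Pt (F.P K).d} {u : GaugeTransf (F.P K) 0 (SU N)}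
    {A : PBond (F.P K) 0 → MatA N} (hN : NrmDbarWideOfRecord F N Mc ρ ν M g K k s U j idx u A) (hk : j ≤ (F.P K).m + (F.P K).K) :
    ∃ w : GaugeTransf (F.P K) 0 (SU N), IsResidual j w ∧
      (∀ i < j, AxialGauge (radialContourData (F.P K) i (SU N)) (Averaging.iter (avOfRecord F N K) i (gaugeAct w U))) ∧
      ∀ (j' : ℕ) (_ : j' ≤ j) (c : PBond (F.P K) j'),
        (domainsMeet (cubeDomains (F.P K) (cornerP (F.P K) Mc ρ idx - ((ρ : ℕ) : Pt (F.P K).d)) (sideP (F.P K) Mc ρ + 2 * ρ) ρ j hk) (domainsOfSeq s.Ω j hk)).LamSite j' c.src →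
        (domainsMeet (cubeDomains (F.P K) (cornerP (F.P K) Mc ρ idx - ((ρ : ℕ) : Pt (F.P K).d)) (sideP (F.P K) Mc ρ + 2 * ρ) ρ j hk) (domainsOfSeq s.Ω j hk)).LamSite j' c.tgt →
          dbarIterU j' (unitsField (toUField (gaugeAct u U))) c =
            emlIterU j' (unitsField (toUField (gaugeAct (fun x => blockLift j (axialGaugeAt (Averaging.iter (avOfRecord F N K) j (gaugeAct w U))
              (tLo (cornerP (F.P K) Mc ρ idx) ρ) (tHi (cornerP (F.P K) Mc ρ idx) (sideP (F.P K) Mc ρ) ρ) (ctr (cornerP (F.P K) Mc ρ idx) (sideP (F.P K) Mc ρ))) x * w x) U))) c := by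
  obtain ⟨w, hres, hax, hnorm⟩ := hN
  refine ⟨w, hres, hax, fun j' hj' c hs ht => ?_⟩
  -- names: the axial representative's gauge map `g = h̄·w`, the accumulated frames `V` of `(U^u)♮` (defined by the recursion)
  set gw : GaugeTransf (F.P K) 0 (SU N) := fun x => blockLift j (axialGaugeAt (Averaging.iter (avOfRecord F N K) j (gaugeAct w U))
      (tLo (cornerP (F.P K) Mc ρ idx) ρ) (tHi (cornerP (F.P K) Mc ρ idx) (sideP (F.P K) Mc ρ) ρ) (ctr (cornerP (F.P K) Mc ρ idx) (sideP (F.P K) Mc ρ))) x * w x with hgw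
  let V : (i : ℕ) → Site (F.P K) i → (Matrix (Fin N) (Fin N) ℂ)ˣ := fun i =>
    Nat.rec (motive := fun i => Site (F.P K) i → (Matrix (Fin N) (Fin N) ℂ)ˣ) (fun _ => 1)
      (fun i Vi y => Vi (emb y) * vframeU (dbarIterU i (unitsField (toUField (gaugeAct u U)))) y) i
  have hV0 : ∀ x, V 0 x = 1 := fun _ => rfl
  have hVs : ∀ (i : ℕ) (y : Site (F.P K) (i + 1)), V (i + 1) y = V i (emb y) * vframeU (dbarIterU i (unitsField (toUField (gaugeAct u U)))) y :=
    fun _ _ => rfl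
  -- (92): `dbar_{j′}((U♮)^{us 0}) = (Ū^{(j′)} U♮)^{V⁻¹·us}` for `us i := toUT (toMS u i)`
  have hUu : unitsField (toUField (gaugeAct u U)) = gaugeActT (toUT (toMS u 0)) (unitsField (toUField U)) := unitsField_toUField_gaugeAct u U
  have hVs' : ∀ (i : ℕ) (y : Site (F.P K) (i + 1)),
      V (i + 1) y = V i (emb y) * vframeU (dbarIterU i (gaugeActT (toUT (toMS u 0)) (unitsField (toUField U)))) y := by
    intro i y
    have h := hVs i y
    rwa [hUu] at h
  have h92 := dbarIterU_gaugeActT_eq (fun i => toUT (toMS u i)) (fun i y => toUT_toMS_succ u i y) (unitsField (toUField U)) V hV0 hVs' j'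
  -- the per-site equation at both ends of `c`
  have hsrc := hnorm hk V hV0 hVs j' hj' c.src hs
  have htgt := hnorm hk V hV0 hVs j' hj' c.tgt ht
  -- the representative's averages: `Ū^{(j′)}((U^{gw})♮) = (Ū^{(j′)} U♮)^{toUT (toMS gw j′)}`
  have hrep : emlIterU j' (unitsField (toUField (gaugeAct gw U))) = gaugeActT (toUT (toMS gw j')) (emlIterU j' (unitsField (toUField U))) := by
    rw [unitsField_toUField_gaugeAct]
    exact emlIterU_gaugeActT (fun i => toUT (toMS gw i)) (fun i y => toUT_toMS_succ gw i y) (unitsField (toUField U)) j'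
  rw [hUu, h92, hrep, gaugeActT_apply, gaugeActT_apply, hsrc, htgt]

/-- ★★ **THE TOP LEVEL**: under the predicate, at every top bond `c` with both ends cells of `D̃`, `U̿^{(j)}(U^u)(c) = Ū^{(j)}_{eml}((U^{h̄w})♮)(c)` AND the representative's record data are the record data,
`M^j(U^w) = M^jU` (`w` residual) — so the chart reads the top data in the rooted axial gauge `h` exactly as in 60′ (the guarded∕unguarded dictionary for `Ū^{(j)}_{eml}` is dag-n07-w2's
`emlIterU_unitsField_eq_iter_of_reads`, applied by the consumer under its smallness). [cite: Balaban1985Variational, (147) p.301, (154) p.302; Balaban1985Averaging, (92) p.31] -/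
theorem NrmDbarWideOfRecord.dbar_eq_top_dataAxial {Mc ρ : ℕ} {ν : Stage7Numerics} {M : ℕ} {g : ℕ → ℝ} {K k : ℕ}
    {s : SeqOfRecord F ν M g K k} {U : GaugeField (F.P K) 0 (SU N)} {j : ℕ} {idx : Pt (F.P K).d} {u : GaugeTransf (F.P K) 0 (SU N)}
    {A : PBond (F.P K) 0 → MatA N} (hN : NrmDbarWideOfRecord F N Mc ρ ν M g K k s U j idx u A) (hk : j ≤ (F.P K).m + (F.P K).K) :
    ∃ w : GaugeTransf (F.P K) 0 (SU N), IsResidual j w ∧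
      (∀ i < j, AxialGauge (radialContourData (F.P K) i (SU N)) (Averaging.iter (avOfRecord F N K) i (gaugeAct w U))) ∧
      Averaging.iter (avOfRecord F N K) j (gaugeAct w U) = Averaging.iter (avOfRecord F N K) j U ∧
      ∀ c : PBond (F.P K) j,
        (domainsMeet (cubeDomains (F.P K) (cornerP (F.P K) Mc ρ idx - ((ρ : ℕ) : Pt (F.P K).d)) (sideP (F.P K) Mc ρ + 2 * ρ) ρ j hk) (domainsOfSeq s.Ω j hk)).LamSite j c.src →
        (domainsMeet (cubeDomains (F.P K) (cornerP (F.P K) Mc ρ idx - ((ρ : ℕ) : Pt (F.P K).d)) (sideP (F.P K) Mc ρ + 2 * ρ) ρ j hk) (domainsOfSeq s.Ω j hk)).LamSite j c.tgt →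
          dbarIterU j (unitsField (toUField (gaugeAct u U))) c =
            emlIterU j (unitsField (toUField (gaugeAct (fun x => blockLift j (axialGaugeAt (Averaging.iter (avOfRecord F N K) j (gaugeAct w U))
              (tLo (cornerP (F.P K) Mc ρ idx) ρ) (tHi (cornerP (F.P K) Mc ρ idx) (sideP (F.P K) Mc ρ) ρ) (ctr (cornerP (F.P K) Mc ρ idx) (sideP (F.P K) Mc ρ))) x * w x) U))) c := by
  obtain ⟨w, hres, hax, hrep⟩ := hN.dbar_eq_iter_rep hk
  exact ⟨w, hres, hax, B12GaugeOrbits021.iter_gaugeAct_of_isResidual (avOfRecord F N K) hk hres U, fun c hs ht => hrep j le_rfl c hs ht⟩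

end Derived

end Summit.QuantumFields.YangMills.BalabanUVNodes.N07NormalisationDbarFramesWide

end
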